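import Literature.MathematicalPhysics.QuantumLattice.HubbardTorusLocalHamiltonianDecomposition
import HarnessLib

/-!
# The Hubbard torus commutator pull-back under the SHARP torus hypothesis
# (`x ↦ x mod L` injective on the window `Λ'` only)

Cell pub-mbboot (bundle `papers/HubbardSuperconductivity/manybody-bootstrap/`, HOME `run/shared/lean/pub/pub-mbboot/`).
HONEST FRAMING: certified numerical bounds on a lattice model; not superconductivity, not a phase diagram.

The tree lemma `Literature.MathematicalPhysics.QuantumLattice.hubbardTorus_commutator_fermionEmbed`
(HubbardTorusLocalHamiltonianDecomposition) proves `[H_L, Γ A] = Γ([H_{Λ'}, A])` for an observable `A`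
of an inner region `Λ ⊆ Λ'` (all lattice neighbours of `Λ` in `Λ'`) under the hypothesis that
`x ↦ x mod L` is injective on the THICKENED window `thicken Λ' 1`; that hypothesis is used once, to make
torus adjacency of image sites REFLECT lattice adjacency on all of `Λ'`
(`fermionTorusGraph_adj_ofTorusSite_proj_iff`), so that `H_L = Γ(H_{Λ'}) + far terms`. For a window of
coordinate spread `M` this costs `L ≥ M + 3`.

This file proves the same commutator identity assuming injectivity on `Λ'` ONLY (`L ≥ M + 1`), by the
per-bond argument already used for the Heisenberg model in the tree
(`heisenbergTorus_commutator_spinEmbed`, HeisenbergWindowCertificate): when `x ↦ x mod L` is injective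
on `Λ'` but not on its thickening, the torus may contain "wrap-around" bonds between image sites that
are not images of lattice bonds of `Λ'`; these are collected in an extra far term
`W = -t Σ_{x,y ∈ Λ', x mod L ∼ y mod L, x ≁ y} Σ_σ c†_{x mod L,σ} c_{y mod L,σ}`
(`hubbardTorus_eq_fermionEmbed_localHamiltonian_add_wrap`), and `W` avoids the image of `Λ`
(`wrap_hopping_mem_carEvenSubalgebra`): a torus neighbour of `x mod L`, `x ∈ Λ`, is `(x ± eᵢ) mod L`
with `x ± eᵢ ∈ Λ'`, hence — by injectivity on `Λ'` — a wrap-around partner `y ∈ Λ'` would equal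
`x ± eᵢ`, a lattice neighbour (`zdAdj_of_fermionTorusGraph_adj_proj`). Consequence:
`hubbardTorus_commutator_fermionEmbed_sharp`, the tree identity with
`hInj : Set.InjOn (Torus.proj L) Λ'`. It is consumed by `WindowCertificateFamilies.lean` of this cell,
whose finite-torus threshold thereby becomes `L ≥ max(3, D')` for a support box of side `D'`
(`HOME/certs/sdp1/SUPPORT-BOX.md`, column `torus_min_L_sharp`) instead of `L ≥ D' + 2`.

New mathematics of this cell only in the weak sense of a sharpened hypothesis of a tree lemma (no
published source states it; method: Bratteli–Robinson II §6.2.1 local commutativity, as cited by the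
tree lemma): placed under the cell topic `Summits/HubbardSuperconductivity/ManyBodyBootstrap/` by the
cell's placement rule, namespace `Summit.HubbardSuperconductivity.ManyBodyBootstrap`.

## References
* O. Bratteli, D. W. Robinson, *Operator Algebras and Quantum Statistical Mechanics 2*, 2nd ed.,
  Springer (1997), §5.2.2, §6.2.1, Thm. 6.2.4. (bib: BratteliRobinsonII1997)
* X. Han, *Quantum many-body bootstrap*, arXiv:2006.06002 (2020), §2 (`F[[H,O]] = 0` evaluated
  locally). (bib: Han2020Bootstrap)
* Tree: `Literature/MathematicalPhysics/QuantumLattice/HubbardTorusLocalHamiltonianDecomposition.lean`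
  (`hubbardTorus_eq_fermionEmbed_localHamiltonian_add`, `far_hopping_mem_carEvenSubalgebra`,
  `far_onSite_mem_carEvenSubalgebra`, `hubbardTorus_commutator_fermionEmbed`),
  `HeisenbergWindowCertificate.lean` (`heisenbergTorus_commutator_spinEmbed`, the model of the argument).
-/

noncomputable section

namespace Summit.HubbardSuperconductivity.ManyBodyBootstrap

open Matrix Finset
open Literature.MathematicalPhysics.QuantumLattice
open Literature.Probability.LatticeModels
open HubbardWave0
open scoped ComplexOrder BigOperators

variable {d : ℕ} (L : ℕ) [NeZero L]

/-! ### Lattice bonds versus torus bonds under `x ↦ x mod L` injective on the window -/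

section Bonds

/-- **Lattice neighbours in the window are torus neighbours**: for `x ∼ y` in `ℤ^d` with `x, y ∈ Λ'`
and `x ↦ x mod L` injective on `Λ'`, `x mod L ∼ y mod L` on the torus (the preserved direction of
`fermionTorusGraph_adj_ofTorusSite_proj_iff`, which needs injectivity only for `x mod L ≠ y mod L`).
[cite: FriedliVelenik2017, §3.1] -/
theorem fermionTorusGraph_adj_proj_of_zdAdj {Λ' : Finset (Site d)}
    (hInj : Set.InjOn (Torus.proj (d := d) L) ↑Λ') {x y : Site d} (hx : x ∈ Λ') (hy : y ∈ Λ')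
    (hxy : (zdGraph d).Adj x y) :
    (fermionTorusGraph d L).Adj (FermionTorus.ofTorusSite (Torus.proj L x))
      (FermionTorus.ofTorusSite (Torus.proj L y)) := by
  have proj_add : ∀ x y : Site d, Torus.proj L (x + y) = Torus.proj L x + Torus.proj L y := fun x y => by
    funext i; simp [Torus.proj]
  rw [fermionTorusGraph_adj, FermionTorus.toTorusSite_ofTorusSite, FermionTorus.toTorusSite_ofTorusSite,
    torusGraph_adj_iff]
  refine ⟨fun h => hxy.ne (hInj hx hy h), ?_⟩
  rw [zdGraph_adj_iff] at hxy
  obtain ⟨i, hi | hi⟩ := hxy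
  · exact Or.inl ⟨i, by rw [hi, proj_add, proj_unitVec]⟩
  · exact Or.inr ⟨i, by rw [hi, proj_add, proj_unitVec]⟩

/-- **A torus bond at the image of the inner region comes from a lattice bond**: if `x ∈ Λ`, all
lattice neighbours of `x` lie in `Λ'`, `y ∈ Λ'`, `x ↦ x mod L` is injective on `Λ'` and
`x mod L ∼ y mod L` on the torus, then `x ∼ y` in `ℤ^d` — the torus neighbour `y mod L = (x ± eᵢ) mod L`
has the preimage `x ± eᵢ ∈ Λ'`, so `y = x ± eᵢ`. No hypothesis on the thickened window.
[cite: FriedliVelenik2017, §3.1] -/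
theorem zdAdj_of_fermionTorusGraph_adj_proj {Λ Λ' : Finset (Site d)}
    (hclosed : ∀ x ∈ Λ, ∀ i : Fin d, x + unitVec i ∈ Λ' ∧ x - unitVec i ∈ Λ')
    (hInj : Set.InjOn (Torus.proj (d := d) L) ↑Λ') {x y : Site d} (hx : x ∈ Λ) (hy : y ∈ Λ')
    (hadj : (fermionTorusGraph d L).Adj (FermionTorus.ofTorusSite (Torus.proj L x))
      (FermionTorus.ofTorusSite (Torus.proj L y))) :
    (zdGraph d).Adj x y := by
  have proj_add : ∀ x y : Site d, Torus.proj L (x + y) = Torus.proj L x + Torus.proj L y := fun x y => by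
    funext i; simp [Torus.proj]
  have proj_sub : ∀ x y : Site d, Torus.proj L (x - y) = Torus.proj L x - Torus.proj L y := fun x y => by
    funext i; simp [Torus.proj]
  rw [fermionTorusGraph_adj, FermionTorus.toTorusSite_ofTorusSite, FermionTorus.toTorusSite_ofTorusSite,
    torusGraph_adj_iff] at hadj
  rw [zdGraph_adj_iff]
  obtain ⟨-, ⟨i, hi⟩ | ⟨i, hi⟩⟩ := hadj
  · -- `y mod L = x mod L + eᵢ = (x + eᵢ) mod L`, `x + eᵢ ∈ Λ'`
    refine ⟨i, Or.inl (hInj hy (hclosed x hx i).1 ?_)⟩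
    rw [hi, proj_add, proj_unitVec]
  · -- `x mod L = y mod L + eᵢ`, so `y mod L = (x - eᵢ) mod L`, `x - eᵢ ∈ Λ'`
    have hy' : y = x - unitVec i := hInj hy (hclosed x hx i).2 (by
      rw [proj_sub, proj_unitVec, hi, add_sub_cancel_right])
    exact ⟨i, Or.inr (by rw [hy']; exact (sub_add_cancel x _).symm)⟩

/-- A site of `Λ'` whose image lies in the image of `Λ ⊆ Λ'` is a site of `Λ` (injectivity on `Λ'`).
[folklore] -/
theorem mem_of_proj_mem_image {Λ Λ' : Finset (Site d)} (hΛ : Λ ⊆ Λ')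
    (hInj : Set.InjOn (Torus.proj (d := d) L) ↑Λ') {x : Site d} (hx : x ∈ Λ')
    (hmem : FermionTorus.ofTorusSite (Torus.proj L x) ∈
      Λ.image fun z => FermionTorus.ofTorusSite (Torus.proj L z)) : x ∈ Λ := by
  obtain ⟨z, hz, hzx⟩ := Finset.mem_image.1 hmem
  have hzx' : z = x := hInj (hΛ hz) hx (by simpa using congrArg FermionTorus.toTorusSite hzx)
  rw [hzx'] at hz
  exact hz

/-- **The wrap-around bonds avoid the image of the inner region**: the hopping terms of the torus bonds
`x mod L ∼ y mod L` between image sites of `Λ'` that are NOT images of lattice bonds (`x ≁ y`) lie in the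
even CAR subalgebra of the orbitals away from the image of `Λ`, whenever every lattice neighbour of `Λ`
is in `Λ'` and `x ↦ x mod L` is injective on `Λ'`. [cite: BratteliRobinsonII1997, §5.2.2] -/
theorem wrap_hopping_mem_carEvenSubalgebra {Λ Λ' : Finset (Site d)} (hΛ : Λ ⊆ Λ')
    (hclosed : ∀ x ∈ Λ, ∀ i : Fin d, x + unitVec i ∈ Λ' ∧ x - unitVec i ∈ Λ')
    (hInj : Set.InjOn (Torus.proj (d := d) L) ↑Λ') :
    (∑ x ∈ Λ', ∑ y ∈ Λ',
        (if (fermionTorusGraph d L).Adj (FermionTorus.ofTorusSite (Torus.proj L x))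
              (FermionTorus.ofTorusSite (Torus.proj L y)) ∧ ¬(zdGraph d).Adj x y then
          ∑ σ : Fin 2, creation (orb (FermionTorus.ofTorusSite (Torus.proj L x)) σ) *
            annihilation (orb (FermionTorus.ofTorusSite (Torus.proj L y)) σ)
        else 0)) ∈
      carEvenSubalgebra (orbs (Λ.image fun x => FermionTorus.ofTorusSite (Torus.proj L x)))ᶜ := by
  refine sum_mem fun x hx => sum_mem fun y hy => ?_
  by_cases h : (fermionTorusGraph d L).Adj (FermionTorus.ofTorusSite (Torus.proj L x))
      (FermionTorus.ofTorusSite (Torus.proj L y)) ∧ ¬(zdGraph d).Adj x y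
  · rw [if_pos h]
    have hxΛ : FermionTorus.ofTorusSite (Torus.proj L x) ∉
        Λ.image fun z => FermionTorus.ofTorusSite (Torus.proj L z) := fun hmem =>
      h.2 (zdAdj_of_fermionTorusGraph_adj_proj L hclosed hInj (mem_of_proj_mem_image L hΛ hInj hx hmem) hy h.1)
    have hyΛ : FermionTorus.ofTorusSite (Torus.proj L y) ∉
        Λ.image fun z => FermionTorus.ofTorusSite (Torus.proj L z) := fun hmem =>
      h.2 (zdAdj_of_fermionTorusGraph_adj_proj L hclosed hInj (mem_of_proj_mem_image L hΛ hInj hy hmem) hx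
        h.1.symm).symm
    exact sum_mem fun σ _ => creation_mul_annihilation_mem_carEvenSubalgebra
      (Finset.mem_compl.2 fun h' => hxΛ (orb_mem_orbs.1 h'))
      (Finset.mem_compl.2 fun h' => hyΛ (orb_mem_orbs.1 h'))
  · rw [if_neg h]
    exact zero_mem _

end Bonds

/-! ### The decomposition `H_L = Γ(H_{Λ'}) + far + wrap-around` -/

section Decomposition

variable (t U : ℝ)

/-- **`H_L = Γ(H_{Λ'}) + far terms + wrap-around bonds`**: for `x ↦ x mod L` injective on `Λ'`
(only), the Hubbard Hamiltonian of the torus is the embedded free-boundary Hamiltonian of `Λ'` plus the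
hopping terms of the torus bonds not inside the image `I'` of `Λ'`, plus the hopping terms of the torus
bonds inside `I'` that are not images of lattice bonds (wrap-around bonds; absent when `x ↦ x mod L` is
injective on `thicken Λ' 1`, cf. the tree's `hubbardTorus_eq_fermionEmbed_localHamiltonian_add`), plus
the repulsion at the sites outside `I'`. [cite: BratteliRobinsonII1997, §6.2.1 (H_Λ' = H_Λ + W)] -/
theorem hubbardTorus_eq_fermionEmbed_localHamiltonian_add_wrap {Λ' : Finset (Site d)}
    (hInj : Set.InjOn (Torus.proj (d := d) L) ↑Λ') :
    hubbardTorus d L t U =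
      fermionEmbed (PolySite.toTorusEmb L hInj) ((hubbardFermionInteraction d t U).localHamiltonian Λ') +
        (-(t : ℂ) • ∑ a : FermionTorus d L, ∑ b : FermionTorus d L,
            (if ¬(a ∈ Λ'.image (fun x => FermionTorus.ofTorusSite (Torus.proj L x)) ∧
                b ∈ Λ'.image (fun x => FermionTorus.ofTorusSite (Torus.proj L x))) then
              ∑ σ : Fin 2, (if (fermionTorusGraph d L).Adj a b then creation (orb a σ) * annihilation (orb b σ) else 0)
            else 0) +
          -(t : ℂ) • ∑ x ∈ Λ', ∑ y ∈ Λ',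
            (if (fermionTorusGraph d L).Adj (FermionTorus.ofTorusSite (Torus.proj L x))
                  (FermionTorus.ofTorusSite (Torus.proj L y)) ∧ ¬(zdGraph d).Adj x y then
              ∑ σ : Fin 2, creation (orb (FermionTorus.ofTorusSite (Torus.proj L x)) σ) *
                annihilation (orb (FermionTorus.ofTorusSite (Torus.proj L y)) σ)
            else 0) +
          (U : ℂ) • ∑ a ∈ (Λ'.image (fun x => FermionTorus.ofTorusSite (Torus.proj L x)))ᶜ,
            numberOp a 0 * numberOp a 1) := by
  have hι : Set.InjOn (fun x : Site d => FermionTorus.ofTorusSite (Torus.proj L x)) ↑Λ' :=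
    injOn_ofTorusSite_proj L hInj
  rw [fermionEmbed_toTorusEmb_localHamiltonian, hubbardTorus, hamiltonian]
  -- the on-site part
  have hsite : ∑ a : FermionTorus d L, numberOp a 0 * numberOp a 1 =
      ∑ x ∈ Λ', numberOp (FermionTorus.ofTorusSite (Torus.proj L x)) 0 *
          numberOp (FermionTorus.ofTorusSite (Torus.proj L x)) 1 +
        ∑ a ∈ (Λ'.image (fun x => FermionTorus.ofTorusSite (Torus.proj L x)))ᶜ, numberOp a 0 * numberOp a 1 := by
    rw [← Finset.sum_add_sum_compl (Λ'.image fun x => FermionTorus.ofTorusSite (Torus.proj L x)),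
      Finset.sum_image hι]
  -- the hopping part: split each term according to whether the bond lies in the image of `Λ'`
  have hsplit : ∀ a b : FermionTorus d L,
      (∑ σ : Fin 2, (if (fermionTorusGraph d L).Adj a b then creation (orb a σ) * annihilation (orb b σ) else 0)) =
        (if a ∈ Λ'.image (fun x => FermionTorus.ofTorusSite (Torus.proj L x)) ∧
            b ∈ Λ'.image (fun x => FermionTorus.ofTorusSite (Torus.proj L x)) then
          ∑ σ : Fin 2, (if (fermionTorusGraph d L).Adj a b then creation (orb a σ) * annihilation (orb b σ) else 0)
          else 0) +
        (if ¬(a ∈ Λ'.image (fun x => FermionTorus.ofTorusSite (Torus.proj L x)) ∧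
            b ∈ Λ'.image (fun x => FermionTorus.ofTorusSite (Torus.proj L x))) then
          ∑ σ : Fin 2, (if (fermionTorusGraph d L).Adj a b then creation (orb a σ) * annihilation (orb b σ) else 0)
          else 0) := by
    intro a b
    by_cases hab : a ∈ Λ'.image (fun x => FermionTorus.ofTorusSite (Torus.proj L x)) ∧
        b ∈ Λ'.image (fun x => FermionTorus.ofTorusSite (Torus.proj L x))
    · rw [if_pos hab, if_neg (not_not.2 hab), add_zero]
    · rw [if_neg hab, if_pos hab, zero_add]
  -- a bond term between image sites is the image of a lattice bond term or a wrap-around term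
  have hterm : ∀ x ∈ Λ', ∀ y ∈ Λ',
      (∑ σ : Fin 2, (if (fermionTorusGraph d L).Adj (FermionTorus.ofTorusSite (Torus.proj L x))
          (FermionTorus.ofTorusSite (Torus.proj L y)) then
        creation (orb (FermionTorus.ofTorusSite (Torus.proj L x)) σ) *
          annihilation (orb (FermionTorus.ofTorusSite (Torus.proj L y)) σ) else 0)) =
        (if (zdGraph d).Adj x y then
            ∑ σ : Fin 2, creation (orb (FermionTorus.ofTorusSite (Torus.proj L x)) σ) *
              annihilation (orb (FermionTorus.ofTorusSite (Torus.proj L y)) σ) else 0) +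
          (if (fermionTorusGraph d L).Adj (FermionTorus.ofTorusSite (Torus.proj L x))
                (FermionTorus.ofTorusSite (Torus.proj L y)) ∧ ¬(zdGraph d).Adj x y then
            ∑ σ : Fin 2, creation (orb (FermionTorus.ofTorusSite (Torus.proj L x)) σ) *
              annihilation (orb (FermionTorus.ofTorusSite (Torus.proj L y)) σ) else 0) := by
    intro x hx y hy
    by_cases hxy : (zdGraph d).Adj x y
    · have hadj := fermionTorusGraph_adj_proj_of_zdAdj L hInj hx hy hxy
      rw [if_pos hxy, if_neg (fun h => h.2 hxy), add_zero]
      exact Finset.sum_congr rfl fun σ _ => if_pos hadj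
    · rw [if_neg hxy, zero_add]
      by_cases hadj : (fermionTorusGraph d L).Adj (FermionTorus.ofTorusSite (Torus.proj L x))
          (FermionTorus.ofTorusSite (Torus.proj L y))
      · rw [if_pos ⟨hadj, hxy⟩]
        exact Finset.sum_congr rfl fun σ _ => if_pos hadj
      · rw [if_neg (fun h => hadj h.1)]
        exact Finset.sum_eq_zero fun σ _ => if_neg hadj
  -- the bonds inside the image
  have hin : ∑ a : FermionTorus d L, ∑ b : FermionTorus d L,
      (if a ∈ Λ'.image (fun x => FermionTorus.ofTorusSite (Torus.proj L x)) ∧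
          b ∈ Λ'.image (fun x => FermionTorus.ofTorusSite (Torus.proj L x)) then
        ∑ σ : Fin 2, (if (fermionTorusGraph d L).Adj a b then creation (orb a σ) * annihilation (orb b σ) else 0)
        else 0) =
      ∑ x ∈ Λ', ∑ y ∈ Λ', (if (zdGraph d).Adj x y then
          ∑ σ : Fin 2, creation (orb (FermionTorus.ofTorusSite (Torus.proj L x)) σ) *
            annihilation (orb (FermionTorus.ofTorusSite (Torus.proj L y)) σ) else 0) +
        ∑ x ∈ Λ', ∑ y ∈ Λ',
          (if (fermionTorusGraph d L).Adj (FermionTorus.ofTorusSite (Torus.proj L x))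
                (FermionTorus.ofTorusSite (Torus.proj L y)) ∧ ¬(zdGraph d).Adj x y then
            ∑ σ : Fin 2, creation (orb (FermionTorus.ofTorusSite (Torus.proj L x)) σ) *
              annihilation (orb (FermionTorus.ofTorusSite (Torus.proj L y)) σ) else 0) := by
    calc ∑ a : FermionTorus d L, ∑ b : FermionTorus d L,
          (if a ∈ Λ'.image (fun x => FermionTorus.ofTorusSite (Torus.proj L x)) ∧
              b ∈ Λ'.image (fun x => FermionTorus.ofTorusSite (Torus.proj L x)) then
            ∑ σ : Fin 2, (if (fermionTorusGraph d L).Adj a b then creation (orb a σ) * annihilation (orb b σ) else 0)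
            else 0)
        = ∑ a : FermionTorus d L, (if a ∈ Λ'.image (fun x => FermionTorus.ofTorusSite (Torus.proj L x)) then
            ∑ b ∈ Λ'.image (fun x => FermionTorus.ofTorusSite (Torus.proj L x)),
              ∑ σ : Fin 2, (if (fermionTorusGraph d L).Adj a b then creation (orb a σ) * annihilation (orb b σ) else 0)
            else 0) := by
          refine Finset.sum_congr rfl fun a _ => ?_
          by_cases ha : a ∈ Λ'.image (fun x => FermionTorus.ofTorusSite (Torus.proj L x))
          · simp only [ha, true_and, if_true]
            rw [Finset.sum_ite_mem, Finset.univ_inter]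
          · simp only [ha, false_and, if_false, Finset.sum_const_zero]
      _ = ∑ a ∈ Λ'.image (fun x => FermionTorus.ofTorusSite (Torus.proj L x)),
            ∑ b ∈ Λ'.image (fun x => FermionTorus.ofTorusSite (Torus.proj L x)),
              ∑ σ : Fin 2, (if (fermionTorusGraph d L).Adj a b then creation (orb a σ) * annihilation (orb b σ) else 0) := by
          rw [Finset.sum_ite_mem, Finset.univ_inter]
      _ = ∑ x ∈ Λ', ∑ y ∈ Λ', ∑ σ : Fin 2,
            (if (fermionTorusGraph d L).Adj (FermionTorus.ofTorusSite (Torus.proj L x))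
                (FermionTorus.ofTorusSite (Torus.proj L y)) then
              creation (orb (FermionTorus.ofTorusSite (Torus.proj L x)) σ) *
                annihilation (orb (FermionTorus.ofTorusSite (Torus.proj L y)) σ) else 0) := by
          rw [Finset.sum_image hι]
          exact Finset.sum_congr rfl fun x _ => Finset.sum_image hι
      _ = _ := by
          rw [← Finset.sum_add_distrib]
          refine Finset.sum_congr rfl fun x hx => ?_
          rw [← Finset.sum_add_distrib]
          exact Finset.sum_congr rfl fun y hy => hterm x hx y hy
  have hhop : ∑ a : FermionTorus d L, ∑ b : FermionTorus d L, ∑ σ : Fin 2,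
        (if (fermionTorusGraph d L).Adj a b then creation (orb a σ) * annihilation (orb b σ) else 0) =
      (∑ x ∈ Λ', ∑ y ∈ Λ', (if (zdGraph d).Adj x y then
          ∑ σ : Fin 2, creation (orb (FermionTorus.ofTorusSite (Torus.proj L x)) σ) *
            annihilation (orb (FermionTorus.ofTorusSite (Torus.proj L y)) σ) else 0) +
        ∑ x ∈ Λ', ∑ y ∈ Λ',
          (if (fermionTorusGraph d L).Adj (FermionTorus.ofTorusSite (Torus.proj L x))
                (FermionTorus.ofTorusSite (Torus.proj L y)) ∧ ¬(zdGraph d).Adj x y then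
            ∑ σ : Fin 2, creation (orb (FermionTorus.ofTorusSite (Torus.proj L x)) σ) *
              annihilation (orb (FermionTorus.ofTorusSite (Torus.proj L y)) σ) else 0)) +
        ∑ a : FermionTorus d L, ∑ b : FermionTorus d L,
            (if ¬(a ∈ Λ'.image (fun x => FermionTorus.ofTorusSite (Torus.proj L x)) ∧
                b ∈ Λ'.image (fun x => FermionTorus.ofTorusSite (Torus.proj L x))) then
              ∑ σ : Fin 2, (if (fermionTorusGraph d L).Adj a b then creation (orb a σ) * annihilation (orb b σ) else 0)
            else 0) := by
    rw [← hin, ← Finset.sum_add_distrib]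
    refine Finset.sum_congr rfl fun a _ => ?_
    rw [← Finset.sum_add_distrib]
    exact Finset.sum_congr rfl fun b _ => hsplit a b
  rw [hhop, hsite, smul_add, smul_add, smul_add]
  abel

/-- **`H_L - Γ(H_{Λ'})` is even and far from `Λ`** under the sharp hypothesis: for `Λ ⊆ Λ'` with all
lattice neighbours of `Λ` in `Λ'` and `x ↦ x mod L` injective on `Λ'`, the difference of the torus
Hamiltonian and the embedded local Hamiltonian of `Λ'` lies in the even CAR subalgebra of the orbitals
away from the image of `Λ` (far terms by the tree lemmas `far_hopping_mem_carEvenSubalgebra`,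
`far_onSite_mem_carEvenSubalgebra`; wrap-around bonds by `wrap_hopping_mem_carEvenSubalgebra`).
[cite: BratteliRobinsonII1997, §6.2.1 and §5.2.2] -/
theorem hubbardTorus_sub_fermionEmbed_localHamiltonian_mem_carEvenSubalgebra_sharp
    {Λ Λ' : Finset (Site d)} (hΛ : Λ ⊆ Λ')
    (hclosed : ∀ x ∈ Λ, ∀ i : Fin d, x + unitVec i ∈ Λ' ∧ x - unitVec i ∈ Λ')
    (hInj : Set.InjOn (Torus.proj (d := d) L) ↑Λ') :
    hubbardTorus d L t U -
        fermionEmbed (PolySite.toTorusEmb L hInj) ((hubbardFermionInteraction d t U).localHamiltonian Λ') ∈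
      carEvenSubalgebra (orbs (Λ.image fun x => FermionTorus.ofTorusSite (Torus.proj L x)))ᶜ := by
  rw [hubbardTorus_eq_fermionEmbed_localHamiltonian_add_wrap L t U hInj, add_sub_cancel_left]
  exact add_mem (add_mem (SMulMemClass.smul_mem _ (far_hopping_mem_carEvenSubalgebra L hΛ hclosed))
      (SMulMemClass.smul_mem _ (wrap_hopping_mem_carEvenSubalgebra L hΛ hclosed hInj)))
    (SMulMemClass.smul_mem _ (far_onSite_mem_carEvenSubalgebra L hΛ))

/-- **Graded locality on the torus** (sharp hypothesis): `H_L - Γ(H_{Λ'})` commutes with every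
embedded observable of `Λ`. [cite: BratteliRobinsonII1997, §5.2.2] -/
theorem commute_hubbardTorus_sub_fermionEmbed_localHamiltonian_sharp {Λ Λ' : Finset (Site d)}
    (hΛ : Λ ⊆ Λ') (hclosed : ∀ x ∈ Λ, ∀ i : Fin d, x + unitVec i ∈ Λ' ∧ x - unitVec i ∈ Λ')
    (hInj : Set.InjOn (Torus.proj (d := d) L) ↑Λ') (A : FermionOp Λ) :
    Commute (hubbardTorus d L t U -
        fermionEmbed (PolySite.toTorusEmb L hInj) ((hubbardFermionInteraction d t U).localHamiltonian Λ'))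
      (fermionEmbed (PolySite.toTorusEmb L hInj) (fermionEmbed (PolySite.incl hΛ) A)) := by
  rw [fermionEmbed_fermionEmbed]
  refine commute_of_mem_carEvenSubalgebra
    (hubbardTorus_sub_fermionEmbed_localHamiltonian_mem_carEvenSubalgebra_sharp L t U hΛ hclosed hInj)
    (fermionEmbed_mem_carSubalgebra _ A) ?_
  exact disjoint_compl_left_iff.2 (orbs_map_incl_trans_toTorusEmb_subset L hΛ _)

/-- **The commutator with the torus Hamiltonian is the embedded local commutator — sharp torus
hypothesis.** For an observable `A` of `Λ`, embedded into the torus through `Λ' ⊇ Λ` (`Λ'` containing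
all lattice neighbours of `Λ`, `x ↦ x mod L` injective on `Λ'` — NOT necessarily on `thicken Λ' 1`),
`[H_L, Γ A] = Γ([H_{Λ'}, A])`; the tree's `hubbardTorus_commutator_fermionEmbed` is the special case of an
injectivity hypothesis on `thicken Λ' 1`. Bratteli–Robinson II Thm. 6.2.4 on the torus.
[cite: BratteliRobinsonII1997, Thm. 6.2.4] -/
theorem hubbardTorus_commutator_fermionEmbed_sharp {Λ Λ' : Finset (Site d)}
    (hΛ : Λ ⊆ Λ') (hclosed : ∀ x ∈ Λ, ∀ i : Fin d, x + unitVec i ∈ Λ' ∧ x - unitVec i ∈ Λ')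
    (hInj : Set.InjOn (Torus.proj (d := d) L) ↑Λ') (A : FermionOp Λ) :
    hubbardTorus d L t U * fermionEmbed (PolySite.toTorusEmb L hInj) (fermionEmbed (PolySite.incl hΛ) A) -
        fermionEmbed (PolySite.toTorusEmb L hInj) (fermionEmbed (PolySite.incl hΛ) A) * hubbardTorus d L t U =
      fermionEmbed (PolySite.toTorusEmb L hInj)
        ((hubbardFermionInteraction d t U).localHamiltonian Λ' * fermionEmbed (PolySite.incl hΛ) A -
          fermionEmbed (PolySite.incl hΛ) A * (hubbardFermionInteraction d t U).localHamiltonian Λ') := by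
  have hc := commute_hubbardTorus_sub_fermionEmbed_localHamiltonian_sharp L t U hΛ hclosed hInj A
  rw [Commute, SemiconjBy, sub_mul, mul_sub, sub_eq_sub_iff_sub_eq_sub] at hc
  rw [fermionEmbed_sub, fermionEmbed_mul, fermionEmbed_mul]
  exact hc

-- The tree lemma `Literature.MathematicalPhysics.QuantumLattice.hubbardTorus_commutator_fermionEmbed`
-- (hypothesis on `thicken Λ' 1`) is the special case `hInj.mono (subset_thicken Λ' 1)` of
-- `hubbardTorus_commutator_fermionEmbed_sharp`; it is not restated here (gate dedup rule).

end Decomposition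

end Summit.HubbardSuperconductivity.ManyBodyBootstrap

end
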